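import Mathlib.Algebra.BigOperators.Fin
import Mathlib.Data.Fin.Tuple.Basic
import Literature.Computability.AlgebraicComplexity.ConstantFreeDegree
import HarnessLib

/-!
# Polynomials for Boolean operations on bit-vectors: `EQ`, `GT`, `LT`, `INC`
# (Chatterjee–Tengse 2023, Observation 2.9) with constant-free circuit bounds

Chatterjee–Tengse, *Lower bounds from succinct hitting sets*, arXiv:2309.07612v2, §2,
Observation 2.9 (v1: Observation 17): "Given vectors `a, b ∈ {0,1}^ℓ`, the following polynomials
(or vectors of polynomials) have constant-free circuits of size `O(ℓ²)`: `EQ(a,b)` (outputs `1` if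
`a = b`, `0` otherwise), `GT(a,b)` (`1` if `a > b` as binary encodings), `LT(a,b)`, `INC(a)` (the
vector `b = a + 1`)."  The source omits the proof ("easy to check"); this file supplies explicit
polynomials over any commutative ring (LSB-first recursion on `Fin ℓ`-indexed vectors,
`Fin.tail`): `BitGadget.EQ/LT/GT/INC` built from the bit-equality indicator
`eqBit a b = ab + (1-a)(1-b)`, their SEMANTICS on `{0,1}`-vectors (`EQ_bitVal`, `LT_bitVal`,
`GT_bitVal` against the encoded numbers `bitsVal`, `INC_bitVal` / `bitsVal_incBits`: increment
modulo `2^ℓ`), and the CIRCUIT BOUNDS in the tree's `(size, formal degree)` calculus `HasTauDeg`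
(`ConstantFreeDegree.lean`: fan-in-two, constants in `{0, ±1}`), compositional in the inputs (each
input entry any polynomial with a circuit of size `≤ s₀`, formal degree `≤ d₀` — variables and the
constants `0/1` have `(0, 1)`, `hasTauDeg_bitVal`): `EQ` size `≤ ℓ(4s₀+8)`, `LT`/`GT` size
`≤ ℓ(ℓ(4s₀+8)+2s₀+5)` (the printed `O(ℓ²)`), each bit of `INC` size `≤ ℓ(3s₀+5)`; and the
compatibility with ring homomorphisms (`map_EQ/LT/GT/INC`: substitution or evaluation of a gadget
is the gadget of the substituted entries) with the EVALUATION FORMS `map_EQ_eq_indicator`,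
`map_LT_eq_indicator`, `map_GT_eq_indicator`, `map_INC_eq_incBits` (the shape an explicit-matrix
encoder consumes: under any ring map sending the entries to the `0/1` values of bit-vectors, the
gadget evaluates to the Boolean answer).

Brick E-b of the engine behind `CT23_thm_3_1` (cell val-lit memo `MEMO-t18g7-CT23-engine.md`;
filed by val-lit t24 under lead-np RULING (95)(b), interface agreed with the engine owner t18):
the gadgets enter the explicit Mahajan–Vinay encoder `G(x,u,v) = EQ(ℓ_v, INC(ℓ_u))·EQ(i_u,i_v)·
GT(j_v,i_u)·C(x,j_u,j_v) + …` of Claim 2.29 (v1: Claim 37) and the validity polynomial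
`valid(u) = LT(0…0, ℓ_u)·LT(ℓ_u, INC(INC(n)))·…`.  Definitions with bodies and theorems only; no
named facts.  Honest framing: elementary gadget bookkeeping; nothing here bears on `VP ≠ VNP`,
which is NOT proved.
-/

namespace Literature.Computability.AlgebraicComplexity

namespace BitGadget

variable {R : Type*} [CommRing R]

/-- The `0/1` value of a bit in the ring `R`. [cite: ChatterjeeTengse2023, Obs. 2.9 (v1: Obs. 17)] -/
def bitVal (x : Bool) : R := if x then 1 else 0

/-- `bitVal true = 1`. [cite: ChatterjeeTengse2023, Obs. 2.9 (v1: Obs. 17)] -/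
@[simp] theorem bitVal_true : (bitVal true : R) = 1 := rfl
/-- `bitVal false = 0`. [cite: ChatterjeeTengse2023, Obs. 2.9 (v1: Obs. 17)] -/
@[simp] theorem bitVal_false : (bitVal false : R) = 0 := rfl

/-- Equality indicator of two bits: `a b + (1 - a)(1 - b)`. [cite: ChatterjeeTengse2023, Obs. 2.9 (v1: Obs. 17)] -/
def eqBit (a b : R) : R := a * b + (1 - a) * (1 - b)

/-- `eqBit` on bits is the equality indicator. [cite: ChatterjeeTengse2023, Obs. 2.9 (v1: Obs. 17)] -/
theorem eqBit_bitVal (x y : Bool) : eqBit (bitVal x : R) (bitVal y) = bitVal (decide (x = y)) := by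
  cases x <;> cases y <;> simp [eqBit, bitVal]

/-- **`EQ(a, b)`**: the product of the bit equality indicators (LSB-first recursion). [cite: ChatterjeeTengse2023, Obs. 2.9 (v1: Obs. 17)] -/
def EQ : (ℓ : ℕ) → (Fin ℓ → R) → (Fin ℓ → R) → R
  | 0, _, _ => 1
  | _ + 1, a, b => eqBit (a 0) (b 0) * EQ _ (Fin.tail a) (Fin.tail b)

/-- **`LT(a, b)`** = `[a < b]` for LSB-first bit-vectors: `(1-a₀) b₀ · EQ(tails) + LT(tails)` — the higher bits decide unless they agree. [cite: ChatterjeeTengse2023, Obs. 2.9 (v1: Obs. 17)] -/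
def LT : (ℓ : ℕ) → (Fin ℓ → R) → (Fin ℓ → R) → R
  | 0, _, _ => 0
  | _ + 1, a, b => (1 - a 0) * b 0 * EQ _ (Fin.tail a) (Fin.tail b) + LT _ (Fin.tail a) (Fin.tail b)

/-- **`GT(a, b)`** `= LT(b, a)`. [cite: ChatterjeeTengse2023, Obs. 2.9 (v1: Obs. 17)] -/
def GT (ℓ : ℕ) (a b : Fin ℓ → R) : R := LT ℓ b a

/-- **`INC(a)`**: the bits of `a + 1 (mod 2^ℓ)`: flip bit `0`; the tail is incremented iff bit `0`
was set (carry), written as the polynomial blend `a₀ · INC(tail) + (1 - a₀) · tail`. [cite: ChatterjeeTengse2023, Obs. 2.9 (v1: Obs. 17)] -/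
def INC : (ℓ : ℕ) → (Fin ℓ → R) → (Fin ℓ → R)
  | 0, a => a
  | _ + 1, a => Fin.cons (1 - a 0)
      (fun i => a 0 * INC _ (Fin.tail a) i + (1 - a 0) * Fin.tail a i)

/-- The number encoded by a bit-vector, least significant bit first ("binary encodings of positive integers"). [cite: ChatterjeeTengse2023, Obs. 2.9 (v1: Obs. 17)] -/
def bitsVal : (ℓ : ℕ) → (Fin ℓ → Bool) → ℕ
  | 0, _ => 0
  | _ + 1, x => (x 0).toNat + 2 * bitsVal _ (Fin.tail x)

/-- An `ℓ`-bit vector encodes a number `< 2^ℓ`. [cite: ChatterjeeTengse2023, Obs. 2.9 (v1: Obs. 17)] -/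
theorem bitsVal_lt_two_pow : ∀ (ℓ : ℕ) (x : Fin ℓ → Bool), bitsVal ℓ x < 2 ^ ℓ
  | 0, _ => by simp [bitsVal]
  | ℓ + 1, x => by
    have := bitsVal_lt_two_pow ℓ (Fin.tail x)
    simp only [bitsVal, pow_succ]
    cases x 0 <;> simp <;> omega

/-- `bitVal` commutes with `Fin.tail`. [cite: ChatterjeeTengse2023, Obs. 2.9 (v1: Obs. 17)] -/
theorem tail_bitVal {ℓ : ℕ} (x : Fin (ℓ + 1) → Bool) :
    Fin.tail (fun i => (bitVal (x i) : R)) = fun i => bitVal (Fin.tail x i) := rfl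

/-- **Semantics of `EQ`**: on bit-vectors, `EQ(x, y) = [x = y]`. [cite: ChatterjeeTengse2023, Obs. 2.9 (v1: Obs. 17)] -/
theorem EQ_bitVal : ∀ (ℓ : ℕ) (x y : Fin ℓ → Bool),
    EQ ℓ (fun i => (bitVal (x i) : R)) (fun i => bitVal (y i)) = bitVal (decide (x = y))
  | 0, x, y => by simp [EQ, Subsingleton.elim x y]
  | ℓ + 1, x, y => by
    simp only [EQ, tail_bitVal, EQ_bitVal ℓ, eqBit_bitVal]
    have hxy : x = y ↔ x 0 = y 0 ∧ Fin.tail x = Fin.tail y := by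
      constructor
      · rintro rfl; exact ⟨rfl, rfl⟩
      · rintro ⟨h0, ht⟩
        calc x = Fin.cons (x 0) (Fin.tail x) := (Fin.cons_self_tail x).symm
          _ = Fin.cons (y 0) (Fin.tail y) := by rw [h0, ht]
          _ = y := Fin.cons_self_tail y
    by_cases h0 : x 0 = y 0 <;> by_cases ht : Fin.tail x = Fin.tail y <;> simp [h0, ht, hxy, bitVal]

/-- Distinct bit-vectors encode distinct numbers. [cite: ChatterjeeTengse2023, Obs. 2.9 (v1: Obs. 17)] -/
theorem bitsVal_injective : ∀ (ℓ : ℕ), Function.Injective (bitsVal ℓ)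
  | 0 => fun x y _ => Subsingleton.elim x y
  | ℓ + 1 => fun x y h => by
    simp only [bitsVal] at h
    have h0 : x 0 = y 0 := by
      have := congrArg (· % 2) h
      simp only [Nat.add_mul_mod_self_left] at this
      cases hx : x 0 <;> cases hy : y 0 <;> simp_all
    have ht : Fin.tail x = Fin.tail y := bitsVal_injective ℓ (by rw [h0] at h; omega)
    calc x = Fin.cons (x 0) (Fin.tail x) := (Fin.cons_self_tail x).symm
      _ = Fin.cons (y 0) (Fin.tail y) := by rw [h0, ht]
      _ = y := Fin.cons_self_tail y

/-- **Semantics of `LT`**: on bit-vectors, `LT(x, y) = [val x < val y]`. [cite: ChatterjeeTengse2023, Obs. 2.9 (v1: Obs. 17)] -/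
theorem LT_bitVal : ∀ (ℓ : ℕ) (x y : Fin ℓ → Bool),
    LT ℓ (fun i => (bitVal (x i) : R)) (fun i => bitVal (y i)) =
      bitVal (decide (bitsVal ℓ x < bitsVal ℓ y))
  | 0, x, y => by simp [LT, bitsVal]
  | ℓ + 1, x, y => by
    simp only [LT, tail_bitVal, LT_bitVal ℓ, EQ_bitVal ℓ, bitsVal]
    have hinj := bitsVal_injective ℓ
    have key : bitsVal (ℓ + 1) x < bitsVal (ℓ + 1) y ↔
        (x 0 = false ∧ y 0 = true ∧ Fin.tail x = Fin.tail y) ∨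
          bitsVal ℓ (Fin.tail x) < bitsVal ℓ (Fin.tail y) := by
      simp only [bitsVal]
      constructor
      · intro h
        by_cases hlt : bitsVal ℓ (Fin.tail x) < bitsVal ℓ (Fin.tail y)
        · exact Or.inr hlt
        · left
          have hle : bitsVal ℓ (Fin.tail y) ≤ bitsVal ℓ (Fin.tail x) := not_lt.1 hlt
          cases hx : x 0 <;> cases hy : y 0 <;> simp [hx, hy] at h ⊢
          · omega
          · exact hinj (by omega)
          · omega
          · omega
      · rintro (⟨hx, hy, ht⟩ | h)
        · rw [hx, hy, ht]; simp
        · cases x 0 <;> cases y 0 <;> simp <;> omega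
    -- the two events are disjoint
    by_cases hlt : bitsVal ℓ (Fin.tail x) < bitsVal ℓ (Fin.tail y)
    · have hne : Fin.tail x ≠ Fin.tail y := fun h => by rw [h] at hlt; exact lt_irrefl _ hlt
      have : bitsVal (ℓ + 1) x < bitsVal (ℓ + 1) y := key.2 (Or.inr hlt)
      simp only [bitsVal] at this
      simp [hlt, hne, this, bitVal]
    · by_cases hc : x 0 = false ∧ y 0 = true ∧ Fin.tail x = Fin.tail y
      · obtain ⟨hx, hy, ht⟩ := hc
        have : bitsVal (ℓ + 1) x < bitsVal (ℓ + 1) y := key.2 (Or.inl ⟨hx, hy, ht⟩)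
        simp only [bitsVal] at this
        simp [hx, hy, ht, bitVal]
      · have hn : ¬ bitsVal (ℓ + 1) x < bitsVal (ℓ + 1) y := fun h => by
          rcases key.1 h with h' | h'
          · exact hc h'
          · exact hlt h'
        simp only [bitsVal] at hn
        simp only [hlt, decide_false, bitVal_false, add_zero, hn]
        cases hx : x 0 <;> cases hy : y 0 <;> simp [bitVal, hx, hy] at hc ⊢
        simp [hc]

/-- Boolean increment modulo `2^ℓ`, LSB-first (the Boolean counterpart of `INC`). [cite: ChatterjeeTengse2023, Obs. 2.9 (v1: Obs. 17)] -/
def incBits : (ℓ : ℕ) → (Fin ℓ → Bool) → (Fin ℓ → Bool)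
  | 0, x => x
  | _ + 1, x => Fin.cons (!x 0) (if x 0 then incBits _ (Fin.tail x) else Fin.tail x)

/-- `incBits` is `+1 (mod 2^ℓ)` on the encoded numbers. [cite: ChatterjeeTengse2023, Obs. 2.9 (v1: Obs. 17)] -/
theorem bitsVal_incBits : ∀ (ℓ : ℕ) (x : Fin ℓ → Bool),
    bitsVal ℓ (incBits ℓ x) = (bitsVal ℓ x + 1) % 2 ^ ℓ
  | 0, x => by simp [bitsVal]
  | ℓ + 1, x => by
    have ih := bitsVal_incBits ℓ (Fin.tail x)
    have hlt := bitsVal_lt_two_pow ℓ (Fin.tail x)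
    simp only [bitsVal, incBits, Fin.cons_zero, Fin.tail_cons]
    cases hx : x 0
    · -- no carry
      simp only [Bool.not_false, Bool.toNat_true, Bool.toNat_false, Bool.false_eq_true, if_false,
        zero_add]
      rw [Nat.mod_eq_of_lt (by rw [pow_succ]; omega)]
      ring
    · -- carry into the tail
      simp only [Bool.not_true, Bool.toNat_false, Bool.toNat_true, if_true, zero_add, ih]
      rw [pow_succ]
      rcases Nat.lt_or_ge (bitsVal ℓ (Fin.tail x) + 1) (2 ^ ℓ) with h | h
      · rw [Nat.mod_eq_of_lt h, Nat.mod_eq_of_lt (by omega)]; ring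
      · have heq : bitsVal ℓ (Fin.tail x) + 1 = 2 ^ ℓ := by omega
        rw [heq, Nat.mod_self]
        have : 1 + 2 * bitsVal ℓ (Fin.tail x) + 1 = 2 ^ ℓ * 2 := by omega
        rw [this, Nat.mod_self]

/-- **Semantics of `INC`**: on bit-vectors, `INC` is the `0/1` image of `incBits`, i.e. the bits
of `val x + 1 (mod 2^ℓ)` (`bitsVal_incBits`). [cite: ChatterjeeTengse2023, Obs. 2.9 (v1: Obs. 17)] -/
theorem INC_bitVal : ∀ (ℓ : ℕ) (x : Fin ℓ → Bool),
    INC ℓ (fun i => (bitVal (x i) : R)) = fun i => bitVal (incBits ℓ x i)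
  | 0, x => by funext i; exact i.elim0
  | ℓ + 1, x => by
    have ih := INC_bitVal ℓ (Fin.tail x)
    funext i
    simp only [INC, incBits, tail_bitVal, ih]
    refine Fin.cases ?_ (fun j => ?_) i
    · cases x 0 <;> simp [bitVal]
    · simp only [Fin.cons_succ, Fin.tail]
      cases x 0 <;> simp [bitVal, Fin.tail]

/-- **Semantics of `GT`**: on bit-vectors, `GT(x, y) = [val y < val x]`. [cite: ChatterjeeTengse2023, Obs. 2.9 (v1: Obs. 17)] -/
theorem GT_bitVal (ℓ : ℕ) (x y : Fin ℓ → Bool) :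
    GT ℓ (fun i => (bitVal (x i) : R)) (fun i => bitVal (y i)) =
      bitVal (decide (bitsVal ℓ y < bitsVal ℓ x)) :=
  LT_bitVal ℓ y x


/-! ### Compatibility with ring homomorphisms (substitution / evaluation of the gadgets) -/

section Map

variable {S : Type*} [CommRing S] (f : R →+* S)

/-- Ring maps commute with `bitVal`. [cite: ChatterjeeTengse2023, Obs. 2.9 (v1: Obs. 17)] -/
@[simp] theorem map_bitVal (x : Bool) : f (bitVal x) = bitVal x := by
  cases x <;> simp [bitVal]

/-- Ring maps commute with `eqBit`. [cite: ChatterjeeTengse2023, Obs. 2.9 (v1: Obs. 17)] -/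
theorem map_eqBit (a b : R) : f (eqBit a b) = eqBit (f a) (f b) := by
  simp [eqBit, map_sub, map_mul, map_add]

/-- Ring maps (e.g. `MvPolynomial.aeval`, `MvPolynomial.eval`) commute with `EQ`: substituting
into the gadget is the gadget of the substituted entries. [cite: ChatterjeeTengse2023, Obs. 2.9 (v1: Obs. 17)] -/
theorem map_EQ : ∀ (ℓ : ℕ) (a b : Fin ℓ → R), f (EQ ℓ a b) = EQ ℓ (f ∘ a) (f ∘ b)
  | 0, _, _ => by simp [EQ]
  | ℓ + 1, a, b => by
    simp only [EQ, map_mul, map_eqBit, map_EQ ℓ]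
    rfl

/-- Ring maps commute with `LT`. [cite: ChatterjeeTengse2023, Obs. 2.9 (v1: Obs. 17)] -/
theorem map_LT : ∀ (ℓ : ℕ) (a b : Fin ℓ → R), f (LT ℓ a b) = LT ℓ (f ∘ a) (f ∘ b)
  | 0, _, _ => by simp [LT]
  | ℓ + 1, a, b => by
    simp only [LT, map_add, map_mul, map_sub, map_one, map_EQ, map_LT ℓ]
    rfl

/-- Ring maps commute with `GT`. [cite: ChatterjeeTengse2023, Obs. 2.9 (v1: Obs. 17)] -/
theorem map_GT (ℓ : ℕ) (a b : Fin ℓ → R) : f (GT ℓ a b) = GT ℓ (f ∘ a) (f ∘ b) :=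
  map_LT f ℓ b a

/-- Ring maps commute with `INC` (componentwise). [cite: ChatterjeeTengse2023, Obs. 2.9 (v1: Obs. 17)] -/
theorem map_INC : ∀ (ℓ : ℕ) (a : Fin ℓ → R) (i : Fin ℓ), f (INC ℓ a i) = INC ℓ (f ∘ a) i
  | 0, _, i => i.elim0
  | ℓ + 1, a, i => by
    refine Fin.cases ?_ (fun j => ?_) i
    · simp [INC, map_sub, map_one]
    · simp only [INC, Fin.cons_succ, map_add, map_mul, map_sub, map_one, map_INC ℓ]
      rfl

/-- **Evaluation form of the `EQ` semantics** (the shape an explicit-matrix encoder consumes):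
under any ring map sending the entries to the `0/1` values of two bit-vectors `x, y`,
`EQ ↦ [x = y]`. [cite: ChatterjeeTengse2023, Obs. 2.9 (v1: Obs. 17)] -/
theorem map_EQ_eq_indicator {ℓ : ℕ} (a b : Fin ℓ → R) (x y : Fin ℓ → Bool)
    (ha : ∀ i, f (a i) = bitVal (x i)) (hb : ∀ i, f (b i) = bitVal (y i)) :
    f (EQ ℓ a b) = bitVal (decide (x = y)) := by
  rw [map_EQ]
  have h1 : (f ∘ a) = fun i => (bitVal (x i) : S) := funext ha
  have h2 : (f ∘ b) = fun i => (bitVal (y i) : S) := funext hb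
  rw [h1, h2, EQ_bitVal]

/-- Evaluation form of the `LT` semantics: `LT ↦ [val x < val y]`. [cite: ChatterjeeTengse2023, Obs. 2.9 (v1: Obs. 17)] -/
theorem map_LT_eq_indicator {ℓ : ℕ} (a b : Fin ℓ → R) (x y : Fin ℓ → Bool)
    (ha : ∀ i, f (a i) = bitVal (x i)) (hb : ∀ i, f (b i) = bitVal (y i)) :
    f (LT ℓ a b) = bitVal (decide (bitsVal ℓ x < bitsVal ℓ y)) := by
  rw [map_LT]
  have h1 : (f ∘ a) = fun i => (bitVal (x i) : S) := funext ha
  have h2 : (f ∘ b) = fun i => (bitVal (y i) : S) := funext hb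
  rw [h1, h2, LT_bitVal]

/-- Evaluation form of the `GT` semantics: `GT ↦ [val y < val x]`. [cite: ChatterjeeTengse2023, Obs. 2.9 (v1: Obs. 17)] -/
theorem map_GT_eq_indicator {ℓ : ℕ} (a b : Fin ℓ → R) (x y : Fin ℓ → Bool)
    (ha : ∀ i, f (a i) = bitVal (x i)) (hb : ∀ i, f (b i) = bitVal (y i)) :
    f (GT ℓ a b) = bitVal (decide (bitsVal ℓ y < bitsVal ℓ x)) :=
  map_LT_eq_indicator f b a y x hb ha

/-- Evaluation form of the `INC` semantics: `INC ↦` the bits of `val x + 1 (mod 2^ℓ)`. [cite: ChatterjeeTengse2023, Obs. 2.9 (v1: Obs. 17)] -/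
theorem map_INC_eq_incBits {ℓ : ℕ} (a : Fin ℓ → R) (x : Fin ℓ → Bool)
    (ha : ∀ i, f (a i) = bitVal (x i)) (i : Fin ℓ) :
    f (INC ℓ a i) = bitVal (incBits ℓ x i) := by
  rw [map_INC]
  have h1 : (f ∘ a) = fun i => (bitVal (x i) : S) := funext ha
  rw [h1, INC_bitVal]

end Map

/-! ### Constant-free fan-in-two circuits: `(size, formal degree)` bounds in the `HasTauDeg` calculus -/

section Circuits

open MvPolynomial

variable {σ : Type*}

/-- `eqBit` of two polynomials with circuits of sizes `≤ s_a, s_b` and formal degree `≤ d₀`: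
size `≤ 2 s_a + 2 s_b + 7`, formal degree `≤ 2 · max 1 d₀`. [cite: ChatterjeeTengse2023, Obs. 2.9 (v1: Obs. 17)] -/
theorem hasTauDeg_eqBit {a b : MvPolynomial σ ℤ} {sa sb d₀ : ℕ} (ha : HasTauDeg a sa d₀)
    (hb : HasTauDeg b sb d₀) : HasTauDeg (eqBit a b) (2 * sa + 2 * sb + 7) (2 * max 1 d₀) := by
  unfold eqBit
  have h1 := ha.mul hb
  have h2 := (ha.one_sub).mul (hb.one_sub)
  refine (h1.add h2).mono (by omega) ?_
  refine max_le ?_ ?_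
  · have : d₀ ≤ max 1 d₀ := le_max_right _ _
    omega
  · omega

/-- **Circuit for `EQ`** (inputs with circuits of size `≤ s₀`, formal degree `≤ d₀`): constant-free,
fan-in two, size `≤ ℓ · (4 s₀ + 8)`, formal degree `≤ 1 + 2 ℓ · max 1 d₀`. [cite: ChatterjeeTengse2023, Obs. 2.9 (v1: Obs. 17)] -/
theorem hasTauDeg_EQ {s₀ d₀ : ℕ} : ∀ (ℓ : ℕ) {a b : Fin ℓ → MvPolynomial σ ℤ}
    (_ : ∀ i, HasTauDeg (a i) s₀ d₀) (_ : ∀ i, HasTauDeg (b i) s₀ d₀),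
    HasTauDeg (EQ ℓ a b) (ℓ * (4 * s₀ + 8)) (1 + 2 * ℓ * max 1 d₀)
  | 0, a, b, _, _ => by simpa [EQ] using (HasTauDeg.one (σ := σ))
  | ℓ + 1, a, b, ha, hb => by
    have ih := hasTauDeg_EQ ℓ (a := Fin.tail a) (b := Fin.tail b) (fun i => ha _) (fun i => hb _)
    have h0 := hasTauDeg_eqBit (ha 0) (hb 0)
    refine (h0.mul ih).mono ?_ ?_
    · ring_nf; omega
    · ring_nf; omega

/-- **Circuit for `LT`**: constant-free, fan-in two, size `≤ ℓ · (ℓ (4 s₀ + 8) + 2 s₀ + 5)` (the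
printed `O(ℓ²)`), formal degree `≤ 3 + 2 (ℓ + 1) · max 1 d₀`. [cite: ChatterjeeTengse2023, Obs. 2.9 (v1: Obs. 17)] -/
theorem hasTauDeg_LT {s₀ d₀ : ℕ} : ∀ (ℓ : ℕ) {a b : Fin ℓ → MvPolynomial σ ℤ}
    (_ : ∀ i, HasTauDeg (a i) s₀ d₀) (_ : ∀ i, HasTauDeg (b i) s₀ d₀),
    HasTauDeg (LT ℓ a b) (ℓ * (ℓ * (4 * s₀ + 8) + 2 * s₀ + 5)) (3 + 2 * (ℓ + 1) * max 1 d₀)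
  | 0, a, b, _, _ => by simpa [LT] using (HasTauDeg.zero (σ := σ)).mono le_rfl (by omega)
  | ℓ + 1, a, b, ha, hb => by
    have ih := hasTauDeg_LT ℓ (a := Fin.tail a) (b := Fin.tail b) (fun i => ha _) (fun i => hb _)
    have hE := hasTauDeg_EQ ℓ (a := Fin.tail a) (b := Fin.tail b) (fun i => ha _) (fun i => hb _)
    have ht := (((ha 0).one_sub).mul (hb 0)).mul hE
    refine (ht.add ih).mono ?_ ?_
    · have : ℓ * (4 * s₀ + 8) ≤ (ℓ + 1) * (4 * s₀ + 8) := Nat.mul_le_mul_right _ (Nat.le_succ ℓ)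
      have : ℓ * (ℓ * (4 * s₀ + 8) + 2 * s₀ + 5) ≤ ℓ * ((ℓ + 1) * (4 * s₀ + 8) + 2 * s₀ + 5) :=
        Nat.mul_le_mul_left _ (by omega)
      ring_nf at *; omega
    · have : d₀ ≤ max 1 d₀ := le_max_right _ _
      have : 1 ≤ max 1 d₀ := le_max_left _ _
      refine max_le ?_ ?_ <;> ring_nf at * <;> nlinarith

/-- **Circuit for `GT`**: same bounds as `LT`. [cite: ChatterjeeTengse2023, Obs. 2.9 (v1: Obs. 17)] -/
theorem hasTauDeg_GT {s₀ d₀ : ℕ} (ℓ : ℕ) {a b : Fin ℓ → MvPolynomial σ ℤ}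
    (ha : ∀ i, HasTauDeg (a i) s₀ d₀) (hb : ∀ i, HasTauDeg (b i) s₀ d₀) :
    HasTauDeg (GT ℓ a b) (ℓ * (ℓ * (4 * s₀ + 8) + 2 * s₀ + 5)) (3 + 2 * (ℓ + 1) * max 1 d₀) :=
  hasTauDeg_LT ℓ hb ha

/-- **Circuits for the bits of `INC`**: each output bit has a constant-free fan-in-two circuit of
size `≤ ℓ · (3 s₀ + 5)` and formal degree `≤ (ℓ + 1) · max 1 d₀`. [cite: ChatterjeeTengse2023, Obs. 2.9 (v1: Obs. 17)] -/
theorem hasTauDeg_INC {s₀ d₀ : ℕ} : ∀ (ℓ : ℕ) {a : Fin ℓ → MvPolynomial σ ℤ}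
    (_ : ∀ i, HasTauDeg (a i) s₀ d₀) (i : Fin ℓ),
    HasTauDeg (INC ℓ a i) (ℓ * (3 * s₀ + 5)) ((ℓ + 1) * max 1 d₀)
  | 0, _, _, i => i.elim0
  | ℓ + 1, a, ha, i => by
    refine Fin.cases ?_ (fun j => ?_) i
    · -- bit 0: `1 - a₀`
      simp only [INC, Fin.cons_zero]
      refine (ha 0).one_sub.mono (by nlinarith) ?_
      have : d₀ ≤ max 1 d₀ := le_max_right _ _
      have : 1 ≤ max 1 d₀ := le_max_left _ _
      refine max_le ?_ ?_ <;> nlinarith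
    · simp only [INC, Fin.cons_succ]
      have ih := hasTauDeg_INC ℓ (a := Fin.tail a) (fun i => ha _) j
      have h := ((ha 0).mul ih).add (((ha 0).one_sub).mul (ha j.succ))
      refine h.mono ?_ ?_
      · ring_nf at *; omega
      · have : d₀ ≤ max 1 d₀ := le_max_right _ _
        have : 1 ≤ max 1 d₀ := le_max_left _ _
        refine max_le ?_ ?_ <;> ring_nf at * <;> nlinarith

/-- The constants `0/1` are admissible inputs (`HasTauDeg _ 0 1`; variables: `HasTauDeg.X`). [cite: ChatterjeeTengse2023, Obs. 2.9 (v1: Obs. 17)] -/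
theorem hasTauDeg_bitVal (c : Bool) : HasTauDeg (bitVal c : MvPolynomial σ ℤ) 0 1 := by
  cases c
  · exact HasTauDeg.zero
  · exact HasTauDeg.one

end Circuits

end BitGadget

end Literature.Computability.AlgebraicComplexity
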